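import Literature.NumberTheory.PAdicHodge.AinfRamifiedConjugateTheta
import Literature.NumberTheory.PAdicHodge.LubinTateLangLimit
import Literature.NumberTheory.PAdicHodge.LubinTateAinfTorsionLiftAction
import Literature.NumberTheory.PAdicHodge.EisensteinCoeffSurjective
import Literature.NumberTheory.PAdicHodge.LubinTateCharacterConjugates
import Literature.NumberTheory.PAdicHodge.FontaineThetaLocalField
import HarnessLib

/-!
# The conjugates `e ∘ χ_π` of a Lubin–Tate character have non-zero eigenvectors in `ℂ_F`, for every totally
# ramified `F/ℚ_p` (`p ≥ 3`): hypothesis (H) of `LubinTateCharacterConjugates`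

Topic `Literature/NumberTheory/PAdicHodge`. Let `F/ℚ_p` be totally ramified of degree `e`, `p ≥ 3`, `π` a uniformizer
with Eisenstein polynomial `f` (an `EisensteinRoot` datum `D` with `D.root = π`, `[F : ℚ_p] = deg f`), `χ_π` the
Lubin–Tate character of `P = πX + X^p`, and `e : F → F̄` a `ℚ_p`-embedding, `e ≠ id`. We prove
★★ `lubinTateCharacterConjugateAdmissible_of_totallyRamified`: the hypothesis
**(H) `LubinTateCharacterConjugateAdmissible F p hp hπ`** — for every such `e` there is `u ∈ ℂ_F`, `u ≠ 0`, with
`σ(u) = e(χ_π(σ))·u` for all `σ` in the Galois group of a finite extension containing the conjugates of `F` — i.e.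
`ℂ_F(e ∘ χ_π) ≠ 0`: the conjugate `e ∘ χ_π` has Hodge–Tate weight `0` (Serre, *Abelian ℓ-adic representations* III §A.5;
Colmez 1993 §I.2). The degree-two case was `LubinTateCharacterConjugatesDegreeTwo` (via the norm `N_{F/ℚ_p} χ_π`);
the present proof covers every degree and uses no `B_dR`.

## The proof (conjugate specialisation of Fontaine's element + Lang's limit)

Let `ρ = e(π) ∈ ℂ_F`: another root of `f`, `ρ ≠ π` (`F = ℚ_p(π)`, `AinfRamifiedConjugateTheta` §1), `‖ρ‖ = ‖π‖`. Let
`θ_ρ : A_inf(𝒪) = 𝔸_inf[X]/(f) → 𝒪_{ℂ_F}` be `θ` on `𝔸_inf` and `X ↦ ρ` (`AinfRamTop.thetaConj`); it is `e` on the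
coefficients `𝒪_D = ℤ_p[π]`, `Γ`-equivariant for `σ` fixing `ρ`, and `θ_ρ ≡ θ_𝒪 (mod ρ − π)`.
Let `x_t ∈ A_inf(𝒪)` be Fontaine's element of the `π`-division tower `t = (0, t₁, t₂, …)` (`LubinTateAinfTorsionLift`):
`x_t = π·x_{t⁺} + x_{t⁺}^p`, `θ_𝒪(x_t) = 0`, `θ_𝒪(x_{t⁺}) = t₁`, and `σ(x_t) = [a]_P(x_t)` whenever `a ∈ 𝒪_D` maps to
`χ_π(σ)` (`LubinTateAinfTorsionLiftAction`, `LubinTateDivisionTowerCoeff`; `𝒪_D → 𝒪_F` is onto for `F` totally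
ramified, `EisensteinCoeffSurjective`).
* §1 `[a]_P(x) = a·x + x²·y` on points (`exists_coe_ltSMul_eq_linear`), and `σ(Pᵐ x) = [a]_P(Pᵐ x)` along the
  `P`-iterates (`gal_ltStep_iterate_of_gal_eq`).
* §2 Apply `θ_ρ`: `y₀ := θ_ρ(x_t)`, `z_m := θ_ρ(Pᵐ x_t) = P_ρᵐ(y₀)` with `P_ρ(z) = ρz + z^p` (`coe_thetaConj_ltStep_iterate`),
  and for `σ` fixing `ρ`: **`‖σ(z_m) − e(χ_π σ)·z_m‖ ≤ ‖z_m‖²`** (`norm_ltMap_iterate_smul_sub_le`).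
* §3 **`y₀ ≠ 0`** — the level-one computation (`ltMap_ne_zero_of_norm_sub_le`, any ultrametric field, `q ≥ 3`):
  `y₁ := θ_ρ(x_{t⁺})` satisfies `‖y₁ − t₁‖ ≤ ‖ρ − π‖` and `y₀ = ρ y₁ + y₁^q`; if `y₀ = 0` then either `y₁ = 0`
  (impossible: `‖t₁‖^{q−1} = ‖π‖` forces `‖t₁‖ > ‖π‖ ≥ ‖ρ − π‖`) or `y₁^{q−1} = −ρ`, and then
  `π − ρ = y₁^{q−1} − t₁^{q−1} = (y₁ − t₁)·S` with `‖S‖ < 1` gives `‖ρ − π‖ < ‖ρ − π‖`.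
  (For `q = 2` this step fails — `p ≥ 3` is used exactly here.) Also `‖y₀‖ ≤ ‖ρ − π‖ ≤ ‖ρ‖`, which puts `y₀` in
  the convergence regime of §4.
* §4 **Lang's limit** `u := λ_ρ(y₀) = lim P_ρᵐ(y₀)/ρᵐ` (`LubinTateLangLimit`): `u ≠ 0` (`‖u‖ = ‖y₀‖`), and the quadratic
  bound of §2 linearises in the limit to **`σ(u) = e(χ_π σ)·u`** (`langLog_eq_mul`, `map_langLog`). ∎

No named facts, no `sorry`. Consumers: `LubinTateCharacterConjugates` / `LubinTateLogCoboundaries` (local algebraicity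
of de Rham characters), `Summit.Langlands…SoloInformedFontaineMazurGL1General` (Fontaine–Mazur for `GL₁`).

## References
* J.-P. Serre, *Abelian ℓ-adic representations and elliptic curves* (1968), Ch. III §A.5. [SerreAbelianLadic1968]
* P. Colmez, *Périodes des variétés abéliennes à multiplication complexe*, Ann. of Math. 138 (1993), §I.2. [Colmez1993]
* S. Lang, *Cyclotomic Fields I and II* (1990), Ch. 8 §6 Lemmas 1–3. [LangCyclotomic1990]
* J.-M. Fontaine, *Le corps des périodes p-adiques*, Astérisque 223 (1994), Exp. II §1.2.2. [FontaineAsterisque223III]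
* J. T. Tate, *p-divisible groups* (1967), §3.3. [Tate1967]
-/

noncomputable section

open Ideal Field WittVector ValuativeRel Filter
open _root_.Topology

namespace Literature.NumberTheory.PAdicHodge

open Literature.NumberTheory.GaloisRepresentations
open Literature.NumberTheory.GaloisRepresentations.IsNonarchimedeanLocalField
open Literature.NumberTheory.GaloisRepresentations.LubinTate

/-! ## §1 `[a]_f(x) = a·x + x²·y` on points, and `σ` along the `P`-iterates -/

section LinearApprox

variable {A : Type*} [CommRing A] [UniformSpace A] [DiscreteUniformity A]
variable {S : Type*} [CommRing S] [UniformSpace S] [IsUniformAddGroup S] [IsTopologicalRing S]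
  [IsLinearTopology S S] [T2Space S] [CompleteSpace S] [Algebra A S] [ContinuousSMul A S]
variable (M : NilIdeal S) {π : A} {q : ℕ} (hA : IsLTRing π q) {f : PowerSeries A} (hf : IsLTSeries π q f)

/-- **`[a]_f(x) = a·x + x²·y`**: the endomorphism `[a]_f = aX + (X²)` of a Lubin–Tate group, evaluated at a
topologically nilpotent point, is `a·x` up to a multiple of `x²`. [cite: LubinTate1965, §1 Thm. 1] -/
theorem exists_coe_ltSMul_eq_linear (a : A) (x : M.toIdeal) :
    ∃ y : S, (ltSMul M hA hf a x : S) = algebraMap A S a * x + (x : S) ^ 2 * y := by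
  have hdvd : (PowerSeries.X : PowerSeries A) ^ 2 ∣ hom hA hf hf a - PowerSeries.C a * PowerSeries.X := by
    rw [PowerSeries.X_pow_dvd_iff]
    intro m hm
    interval_cases m
    · rw [map_sub, PowerSeries.coeff_C_mul, PowerSeries.coeff_zero_X, mul_zero, sub_zero,
        PowerSeries.coeff_zero_eq_constantCoeff_apply, constantCoeff_hom]
    · rw [map_sub, coeff_one_hom, PowerSeries.coeff_C_mul, PowerSeries.coeff_one_X, mul_one, sub_self]
  obtain ⟨h, hh⟩ := hdvd
  refine ⟨PowerSeries.aeval (M.isTopologicallyNilpotent _ x.2) h, ?_⟩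
  have hg : hom hA hf hf a = ((Polynomial.C a * Polynomial.X : Polynomial A) : PowerSeries A) +
      ((Polynomial.X ^ 2 : Polynomial A) : PowerSeries A) * h := by
    rw [Polynomial.coe_mul, Polynomial.coe_C, Polynomial.coe_X, Polynomial.coe_pow, Polynomial.coe_X, ← hh]; ring
  rw [ltSMul, coe_evalPt₁, hg, map_add, map_mul, PowerSeries.aeval_coe, PowerSeries.aeval_coe, map_mul,
    Polynomial.aeval_C, Polynomial.aeval_X, map_pow, Polynomial.aeval_X]

end LinearApprox

/-! ## §3 (stated first, field-theoretic) The level-one computation: `ρ y₁ + y₁^q ≠ 0` -/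

section KeyLemma

variable {K : Type*} [NormedField K] [IsUltrametricDist K]

/-- **Level-one lemma.** In an ultrametric field let `q ≥ 3`, `‖ρ‖ = ‖ϖ‖ < 1`, `ρ ≠ ϖ`, `ϖ t + t^q = 0`, `t ≠ 0`
(a primitive `ϖ`-division point of `P = ϖX + X^q`) and `‖y − t‖ ≤ ‖ρ − ϖ‖`. Then **`ρ y + y^q ≠ 0`**: `y` is NOT a
`ρ`-division point of the conjugate polynomial `P_ρ = ρX + X^q`. (False for `q = 2`.)
[cite: SerreAbelianLadic1968, Ch. III §A.5] [cite: Colmez1993, §I.2] -/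
theorem ltMap_ne_zero_of_norm_sub_le {q : ℕ} (hq : 3 ≤ q) {ρ ϖ t y : K} (hρϖ : ‖ρ‖ = ‖ϖ‖) (hne : ρ ≠ ϖ)
    (hϖ1 : ‖ϖ‖ < 1) (ht : ϖ * t + t ^ q = 0) (ht0 : t ≠ 0) (hy : ‖y - t‖ ≤ ‖ρ - ϖ‖) : ρ * y + y ^ q ≠ 0 := by
  have hfactor : ∀ c z : K, c * z + z ^ q = z * (c + z ^ (q - 1)) := fun c z => by
    rw [mul_add, ← pow_succ', Nat.sub_add_cancel (by omega : 1 ≤ q), mul_comm]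
  -- `t^{q-1} = -ϖ`, `‖t‖^{q-1} = ‖ϖ‖`
  have htq : t ^ (q - 1) = -ϖ := by
    rw [hfactor] at ht
    rcases mul_eq_zero.1 ht with h | h
    · exact absurd h ht0
    · exact (neg_eq_of_add_eq_zero_right h).symm
  have hnt : ‖t‖ ^ (q - 1) = ‖ϖ‖ := by rw [← norm_pow, htq, norm_neg]
  have htpos : 0 < ‖t‖ := norm_pos_iff.2 ht0
  have hϖpos : 0 < ‖ϖ‖ := by rw [← hnt]; exact pow_pos htpos _
  have hρϖ' : ‖ρ - ϖ‖ ≤ ‖ϖ‖ := by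
    have h := IsUltrametricDist.norm_add_le_max ρ (-ϖ)
    rwa [← sub_eq_add_neg, norm_neg, hρϖ, max_self] at h
  have ht1 : ‖t‖ < 1 := by
    by_contra hge
    rw [not_lt] at hge
    exact absurd ((one_le_pow₀ hge).trans_eq hnt) (not_le.2 hϖ1)
  intro h0
  rw [hfactor] at h0
  rcases mul_eq_zero.1 h0 with hy0 | hyq
  · -- `y = 0`: `‖t‖ ≤ ‖ρ − ϖ‖ ≤ ‖ϖ‖`, contradicting `‖t‖^{q-1} = ‖ϖ‖`, `q − 1 ≥ 2`, `‖ϖ‖ < 1`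
    rw [hy0, zero_sub, norm_neg] at hy
    have h1 : ‖ϖ‖ ≤ ‖ϖ‖ ^ (q - 1) :=
      calc ‖ϖ‖ = ‖t‖ ^ (q - 1) := hnt.symm
        _ ≤ ‖ϖ‖ ^ (q - 1) := pow_le_pow_left₀ (norm_nonneg _) (hy.trans hρϖ') _
    exact absurd (pow_lt_self_of_lt_one₀ hϖpos hϖ1 (by omega : 1 < q - 1)) (not_lt.2 h1)
  · -- `y^{q-1} = -ρ`: `ϖ − ρ = y^{q-1} − t^{q-1} = S·(y − t)` with `‖S‖ < 1`
    have hyq' : y ^ (q - 1) = -ρ := (neg_eq_of_add_eq_zero_right hyq).symm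
    have hny : ‖y‖ ^ (q - 1) = ‖ρ‖ := by rw [← norm_pow, hyq', norm_neg]
    have hy1 : ‖y‖ < 1 := by
      by_contra hge
      rw [not_lt] at hge
      have h1 : (1 : ℝ) ≤ ‖ρ‖ := (one_le_pow₀ hge).trans_eq hny
      rw [hρϖ] at h1
      exact absurd h1 (not_le.2 hϖ1)
    set r : ℝ := max ‖y‖ ‖t‖ with hr
    have hr1 : r < 1 := max_lt hy1 ht1
    have hr0 : 0 ≤ r := le_max_of_le_left (norm_nonneg _)
    have hS : ‖∑ i ∈ Finset.range (q - 1), y ^ i * t ^ (q - 1 - 1 - i)‖ ≤ r := by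
      refine IsUltrametricDist.norm_sum_le_of_forall_le_of_nonneg hr0 fun i hi => ?_
      rw [Finset.mem_range] at hi
      rw [norm_mul, norm_pow, norm_pow]
      calc ‖y‖ ^ i * ‖t‖ ^ (q - 1 - 1 - i) ≤ r ^ i * r ^ (q - 1 - 1 - i) := by
            gcongr
            · exact le_max_left _ _
            · exact le_max_right _ _
        _ = r ^ (q - 2) := by rw [← pow_add]; congr 1; omega
        _ ≤ r := pow_le_of_le_one hr0 hr1.le (by omega)
    have hdiff : (∑ i ∈ Finset.range (q - 1), y ^ i * t ^ (q - 1 - 1 - i)) * (y - t) = ϖ - ρ := by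
      rw [geom_sum₂_mul, hyq', htq]; ring
    have hρϖpos : 0 < ‖ρ - ϖ‖ := norm_pos_iff.2 (sub_ne_zero.2 hne)
    have hlt : ‖ϖ - ρ‖ < ‖ρ - ϖ‖ := by
      rw [← hdiff, norm_mul]
      calc ‖∑ i ∈ Finset.range (q - 1), y ^ i * t ^ (q - 1 - 1 - i)‖ * ‖y - t‖ ≤ r * ‖ρ - ϖ‖ :=
            mul_le_mul hS hy (norm_nonneg _) hr0
        _ < 1 * ‖ρ - ϖ‖ := mul_lt_mul_of_pos_right hr1 hρϖpos
        _ = ‖ρ - ϖ‖ := one_mul _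
    rw [norm_sub_rev] at hlt
    exact lt_irrefl _ hlt

end KeyLemma

/-! ## §2 `θ_ρ` along the `P`-iterates: `z_m = P_ρᵐ(z₀)` and `‖σ z_m − e(χ_π σ) z_m‖ ≤ ‖z_m‖²` -/

variable {F : Type} [Field F] [ValuativeRel F] [TopologicalSpace F] [IsNonarchimedeanLocalField F] [CharZero F]
  {p : ℕ} [Fact p.Prime] {hp : valuation F p < 1} {D : EisensteinRoot F p hp}

namespace AinfRamTop

variable [Fact (¬ IsUnit (p : integerC F))] [IsAdicComplete (Ideal.span {(p : integerC F)}) (integerC F)]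
  {hθ : Function.Surjective (fontaineTheta (integerC F) p)} {c : EisensteinRoot.CoeffDisc D} {q : ℕ} {hq : q ≠ 0}
  (hA : IsLTRing c q) (hf : IsLTSeries c q (ltSeries c q))

/-- **`σ(Pᵐ x) = [a]_P(Pᵐ x)` for all `m`, once `σ x = [a]_P x`** (`σ` and `[a]_P` both commute with `P`).
[cite: LubinTate1965, §1 Thm. 1 (9)] [cite: FontaineAsterisque223III, Exp. II §1.2.2] -/
theorem gal_ltStep_iterate_of_gal_eq (σ : absoluteGaloisGroup F) (a : EisensteinRoot.CoeffDisc D)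
    {X : (nilTheta D hθ).toIdeal}
    (hX : gal D σ (X : AinfRamTop D) = (ltSMul (nilTheta D hθ) hA hf a X : AinfRamTop D)) (m : ℕ) :
    gal D σ (((ltStep c hq)^[m] X : (nilTheta D hθ).toIdeal) : AinfRamTop D) =
      (ltSMul (nilTheta D hθ) hA hf a ((ltStep c hq)^[m] X) : AinfRamTop D) := by
  induction m with
  | zero => exact hX
  | succ m ih =>
    rw [Function.iterate_succ_apply', gal_ltStep c hq σ, ltSMul_ltStep hA hf a]
    exact congrArg (fun Z : (nilTheta D hθ).toIdeal => ((ltStep c hq Z : (nilTheta D hθ).toIdeal) : AinfRamTop D))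
      (Subtype.ext ih)

variable (D) {ρ : CompletedAlgClosure F}
  (hρ : D.poly.eval₂ ((algebraMap F (CompletedAlgClosure F)).comp (zpToF hp)) ρ = 0)

/-- **`θ_ρ(Pᵐ x) = P_{θ_ρ(c)}ᵐ(θ_ρ x)`**: under `θ_ρ` the `P`-iteration in `A_inf(𝒪)` becomes the iteration of
`z ↦ θ_ρ(c)·z + z^q` in `ℂ_F`. [cite: LangCyclotomic1990, Ch. 8 §6 Lemma 1] [cite: SerreAbelianLadic1968, Ch. III §A.5] -/
theorem coe_thetaConj_ltStep_iterate (X : (nilTheta D hθ).toIdeal) (m : ℕ) :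
    ((thetaConj D hρ (((ltStep c hq)^[m] X : (nilTheta D hθ).toIdeal) : AinfRamTop D) : CBall F) :
        CompletedAlgClosure F) =
      (LangLimit.ltMap
          ((thetaConj D hρ (algebraMap (EisensteinRoot.CoeffDisc D) (AinfRamTop D) c) : CBall F) :
            CompletedAlgClosure F) q)^[m]
        ((thetaConj D hρ (X : AinfRamTop D) : CBall F) : CompletedAlgClosure F) := by
  induction m with
  | zero => rfl
  | succ m ih =>
    rw [Function.iterate_succ_apply', Function.iterate_succ_apply', coe_ltStep, map_add, map_mul, map_pow,
      Subring.coe_add, Subring.coe_mul, SubmonoidClass.coe_pow, ih]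
    rfl

/-- **`‖σ(θ_ρ x) − θ_ρ(a)·θ_ρ(x)‖ ≤ ‖θ_ρ x‖²`** when `σ x = [a]_P x` and `σ` fixes `ρ` (`θ_ρ` is `Γ`-equivariant,
`[a]_P x = a x + x² y`, `‖θ_ρ y‖ ≤ 1`). [cite: SerreAbelianLadic1968, Ch. III §A.5] [cite: Tate1967, §3.3] -/
theorem norm_smul_thetaConj_sub_le (σ : absoluteGaloisGroup F) (hσ : σ • ρ = ρ) (a : EisensteinRoot.CoeffDisc D)
    {X : (nilTheta D hθ).toIdeal}
    (hX : gal D σ (X : AinfRamTop D) = (ltSMul (nilTheta D hθ) hA hf a X : AinfRamTop D)) :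
    ‖σ • ((thetaConj D hρ (X : AinfRamTop D) : CBall F) : CompletedAlgClosure F) -
        ((thetaConj D hρ (algebraMap (EisensteinRoot.CoeffDisc D) (AinfRamTop D) a) : CBall F) :
            CompletedAlgClosure F) *
          ((thetaConj D hρ (X : AinfRamTop D) : CBall F) : CompletedAlgClosure F)‖ ≤
      ‖((thetaConj D hρ (X : AinfRamTop D) : CBall F) : CompletedAlgClosure F)‖ ^ 2 := by
  obtain ⟨y, hy⟩ := exists_coe_ltSMul_eq_linear (nilTheta D hθ) hA hf a X
  rw [← coe_thetaConj_gal D hρ σ hσ, hX, hy, map_add, map_mul, map_mul, map_pow, Subring.coe_add, Subring.coe_mul,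
    Subring.coe_mul, SubmonoidClass.coe_pow, add_sub_cancel_left, norm_mul, norm_pow]
  exact mul_le_of_le_one_right (pow_nonneg (norm_nonneg _) 2) (norm_thetaConj_le_one D hρ _)

/-- ★ **The quadratic bound along the whole orbit**: with `z = θ_ρ(x)`, `κ_c = θ_ρ(c)`, `κ = θ_ρ(a)`, `σ x = [a]_P x`,
`σ ρ = ρ`: `‖P_{κ_c}ᵐ(σ z) − κ·P_{κ_c}ᵐ(z)‖ ≤ ‖P_{κ_c}ᵐ(z)‖²` for all `m` (hypothesis `h` of `LangLimit.langLog_eq_mul`).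
[cite: SerreAbelianLadic1968, Ch. III §A.5] [cite: LangCyclotomic1990, Ch. 8 §6 Lemma 2] -/
theorem norm_ltMap_iterate_smul_sub_le (σ : absoluteGaloisGroup F) (hσ : σ • ρ = ρ) (a : EisensteinRoot.CoeffDisc D)
    {X : (nilTheta D hθ).toIdeal}
    (hX : gal D σ (X : AinfRamTop D) = (ltSMul (nilTheta D hθ) hA hf a X : AinfRamTop D)) (m : ℕ) :
    ‖(LangLimit.ltMap
          ((thetaConj D hρ (algebraMap (EisensteinRoot.CoeffDisc D) (AinfRamTop D) c) : CBall F) :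
            CompletedAlgClosure F) q)^[m]
          (σ • ((thetaConj D hρ (X : AinfRamTop D) : CBall F) : CompletedAlgClosure F)) -
        ((thetaConj D hρ (algebraMap (EisensteinRoot.CoeffDisc D) (AinfRamTop D) a) : CBall F) :
            CompletedAlgClosure F) *
          (LangLimit.ltMap
            ((thetaConj D hρ (algebraMap (EisensteinRoot.CoeffDisc D) (AinfRamTop D) c) : CBall F) :
              CompletedAlgClosure F) q)^[m]
            ((thetaConj D hρ (X : AinfRamTop D) : CBall F) : CompletedAlgClosure F)‖ ≤
      ‖(LangLimit.ltMap
          ((thetaConj D hρ (algebraMap (EisensteinRoot.CoeffDisc D) (AinfRamTop D) c) : CBall F) :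
            CompletedAlgClosure F) q)^[m]
          ((thetaConj D hρ (X : AinfRamTop D) : CBall F) : CompletedAlgClosure F)‖ ^ 2 := by
  have hs : CompletedAlgClosure.galRingHom σ
      ((thetaConj D hρ (algebraMap (EisensteinRoot.CoeffDisc D) (AinfRamTop D) c) : CBall F) :
        CompletedAlgClosure F) =
      ((thetaConj D hρ (algebraMap (EisensteinRoot.CoeffDisc D) (AinfRamTop D) c) : CBall F) :
        CompletedAlgClosure F) := by
    rw [← CompletedAlgClosure.smul_def, ← coe_thetaConj_gal D hρ σ hσ, EisensteinRoot.gal_algebraMap_coeffDisc]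
  have hq0 : q ≠ 0 := by
    obtain ⟨p', r, hp', hqr, -⟩ := hA.exists_prime
    rw [hqr]; exact pow_ne_zero _ hp'.ne_zero
  have h1 := norm_smul_thetaConj_sub_le D hA hf hρ σ hσ a (gal_ltStep_iterate_of_gal_eq (hq := hq0) hA hf σ a hX m)
  rw [coe_thetaConj_ltStep_iterate D hρ X m, CompletedAlgClosure.smul_def, LangLimit.map_ltMap_iterate _ hs,
    ← CompletedAlgClosure.smul_def] at h1
  exact h1

end AinfRamTop

/-! ## §4 ★★ Hypothesis (H) for totally ramified `F` -/

/-- ★★ **Hypothesis (H) of the Lubin–Tate character files for every totally ramified `F/ℚ_p`, `p ≥ 3`**: for an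
Eisenstein datum `D` of `F` with `D.root = π` a uniformizer and `[F : ℚ_p] = deg f` (so `#k_F = p`), every
`ℚ_p`-embedding `e ≠ id` of `F` admits `u ∈ ℂ_F`, `u ≠ 0`, with `σ(u) = e(χ_π σ)·u` for all `σ ∈ Γ_M` (`M ⊇ e'(F)` for
all `e'`) — `u = λ_ρ(θ_ρ(x_t))`, Lang's limit of the conjugate specialisation of Fontaine's element of the
`π`-division tower. [cite: SerreAbelianLadic1968, Ch. III §A.5] [cite: Colmez1993, §I.2] [cite: LangCyclotomic1990, Ch. 8 §6]
[cite: FontaineAsterisque223III, Exp. II §1.2.2] -/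
theorem lubinTateCharacterConjugateAdmissible_of_totallyRamified (D : EisensteinRoot F p hp) {π : 𝒪[F]}
    (hπ : (valuation F).IsUniformizer (π : F)) (hπD : (π : F) = D.root) (hk : residueFieldCard F = p) (hp3 : 3 ≤ p)
    (hd : Module.finrank (PadicBase F p hp) F = D.e) :
    LubinTateCharacterConjugateAdmissible F p hp hπ := by
  intro M _ hM e he
  haveI : Fact (¬ IsUnit (p : integerC F)) := ⟨not_isUnit_natCast_integerC hp⟩
  haveI := isAdicComplete_integerC_natCast (F := F) hp
  have hθ : Function.Surjective (fontaineTheta (integerC F) p) := surjective_fontaineTheta_integerC hp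
  have hpq : p ∣ residueFieldCard F := hk ▸ dvd_rfl
  have hq3 : 3 ≤ residueFieldCard F := hk ▸ hp3
  have hq2 : 2 ≤ residueFieldCard F := one_lt_residueFieldCard F
  have hA : IsLTRing (EisensteinRoot.CoeffDisc.of D (AdjoinRoot.root D.poly)) (residueFieldCard F) := by
    rw [hk]; simpa using D.isLTRing_coeffDisc 1
  have hf : IsLTSeries (EisensteinRoot.CoeffDisc.of D (AdjoinRoot.root D.poly)) (residueFieldCard F)
      (ltSeries (EisensteinRoot.CoeffDisc.of D (AdjoinRoot.root D.poly)) (residueFieldCard F)) :=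
    isLTSeries_ltSeries _ (one_lt_residueFieldCard F)
  have htp := EisensteinRoot.ltStepC_ltDivTower_succ D hπ hπD
  -- the conjugate root `ρ = e(π)` of `f`
  have hρ : D.poly.eval₂ ((algebraMap F (CompletedAlgClosure F)).comp (zpToF hp))
      ((e D.root : NormedAlgClosure F) : CompletedAlgClosure F) = 0 := D.isRoot_embedding e
  have hϖ1 : ‖algebraMap F (CompletedAlgClosure F) D.root‖ < 1 := D.norm_algebraMap_root_lt_one
  have hρϖ : ‖((e D.root : NormedAlgClosure F) : CompletedAlgClosure F)‖ = ‖algebraMap F (CompletedAlgClosure F) D.root‖ :=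
    D.norm_eq_norm_root_of_isRoot hρ
  have hne : ((e D.root : NormedAlgClosure F) : CompletedAlgClosure F) ≠ algebraMap F (CompletedAlgClosure F) D.root :=
    fun h => D.embedding_root_ne hd e he
      (UniformSpace.Completion.coe_injective (NormedAlgClosure F) (h.trans (CompletedAlgClosure.algebraMap_eq_coe _)))
  have hϖ0 : algebraMap F (CompletedAlgClosure F) D.root ≠ 0 := by
    intro h
    have h1 := D.norm_algebraMap_root_pow
    rw [h, norm_zero, zero_pow D.e_pos.ne'] at h1
    exact natCast_C_ne_zero (Fact.out : p.Prime).ne_zero (norm_eq_zero.1 h1.symm)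
  have hρ0 : ((e D.root : NormedAlgClosure F) : CompletedAlgClosure F) ≠ 0 := by
    rw [← norm_pos_iff, hρϖ, norm_pos_iff]; exact hϖ0
  have hρ1 : ‖((e D.root : NormedAlgClosure F) : CompletedAlgClosure F)‖ < 1 := hρϖ ▸ hϖ1
  -- `θ_ρ(c) = ρ` for the coefficient `c = ϖ_D`
  have hκc : ((AinfRamTop.thetaConj D hρ (algebraMap (EisensteinRoot.CoeffDisc D) (AinfRamTop D)
      (EisensteinRoot.CoeffDisc.of D (AdjoinRoot.root D.poly))) : CBall F) : CompletedAlgClosure F) =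
      ((e D.root : NormedAlgClosure F) : CompletedAlgClosure F) :=
    AinfRamTop.coe_thetaConj_algebraMap_varpiDisc D e
  -- Fontaine's elements `x_t`, `x_{t⁺}` and their conjugate images `y₀`, `y₁`
  set x₀ : AinfRamTop D := AinfRamTop.ltTorsionLift (EisensteinRoot.CoeffDisc.of D (AdjoinRoot.root D.poly))
      (residueFieldCard_ne_zero F) hpq (k := D.e) AinfRamTop.algebraMap_varpiDisc_pow_mem_ideal hθ (ltDivTower hπ) htp
    with hx₀def
  set x₁ : AinfRamTop D := AinfRamTop.ltTorsionLift (EisensteinRoot.CoeffDisc.of D (AdjoinRoot.root D.poly))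
      (residueFieldCard_ne_zero F) hpq (k := D.e) AinfRamTop.algebraMap_varpiDisc_pow_mem_ideal hθ
      (fun m => ltDivTower hπ (m + 1)) (AinfRamTop.ltStepC_shift htp 1) with hx₁def
  have hx₀mem : x₀ ∈ (AinfRamTop.nilTheta D hθ).toIdeal := by
    rw [hx₀def]; exact AinfRamTop.ltTorsionLift_mem_nilTheta hpq _ htp
  -- `θ_𝒪(x_t) = t₀ = 0`, `θ_𝒪(x_{t⁺}) = t₁`, `x_t = c·x_{t⁺} + x_{t⁺}^q`
  have hθx₀ : ((AinfRamTop.theta D x₀ : CBall F) : CompletedAlgClosure F) = 0 := by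
    rw [hx₀def, AinfRamTop.theta_ltTorsionLift, coe_ltDivTower_zero, Subring.coe_zero]
  have hθx₁ : AinfRamTop.theta D x₁ = ((ltDivTower hπ 1 : (maxNilIdealC F).toIdeal) : CBall F) := by
    rw [hx₁def, AinfRamTop.theta_ltTorsionLift_shift hpq _ htp]
  have hx₀₁ : x₀ = algebraMap (EisensteinRoot.CoeffDisc D) (AinfRamTop D)
      (EisensteinRoot.CoeffDisc.of D (AdjoinRoot.root D.poly)) * x₁ + x₁ ^ residueFieldCard F := by
    rw [hx₀def, hx₁def]; exact AinfRamTop.coe_ltTorsionLift_eq_shift hpq _ htp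
  -- `y₀ = θ_ρ(x_t)`, `y₁ = θ_ρ(x_{t⁺})`: `‖y₀‖ ≤ ‖ρ − ϖ‖`, `‖y₁ − t₁‖ ≤ ‖ρ − ϖ‖`, `y₀ = ρ y₁ + y₁^q`
  have hy₀le : ‖((AinfRamTop.thetaConj D hρ x₀ : CBall F) : CompletedAlgClosure F)‖ ≤
      ‖((e D.root : NormedAlgClosure F) : CompletedAlgClosure F) - algebraMap F (CompletedAlgClosure F) D.root‖ := by
    have h := AinfRamTop.norm_thetaConj_sub_theta_le D hρ x₀
    rwa [hθx₀, sub_zero] at h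
  have hy₁le : ‖((AinfRamTop.thetaConj D hρ x₁ : CBall F) : CompletedAlgClosure F) -
      (((ltDivTower hπ 1 : (maxNilIdealC F).toIdeal) : CBall F) : CompletedAlgClosure F)‖ ≤
      ‖((e D.root : NormedAlgClosure F) : CompletedAlgClosure F) - algebraMap F (CompletedAlgClosure F) D.root‖ := by
    have h := AinfRamTop.norm_thetaConj_sub_theta_le D hρ x₁
    rwa [hθx₁] at h
  have hy₀₁ : ((AinfRamTop.thetaConj D hρ x₀ : CBall F) : CompletedAlgClosure F) =
      ((e D.root : NormedAlgClosure F) : CompletedAlgClosure F) *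
          ((AinfRamTop.thetaConj D hρ x₁ : CBall F) : CompletedAlgClosure F) +
        ((AinfRamTop.thetaConj D hρ x₁ : CBall F) : CompletedAlgClosure F) ^ residueFieldCard F := by
    rw [hx₀₁, map_add, map_mul, map_pow, Subring.coe_add, Subring.coe_mul, SubmonoidClass.coe_pow, hκc]
  -- the level-one relations `ϖ t₁ + t₁^q = 0`, `t₁ ≠ 0`
  have ht : algebraMap F (CompletedAlgClosure F) D.root *
        (((ltDivTower hπ 1 : (maxNilIdealC F).toIdeal) : CBall F) : CompletedAlgClosure F) +
      (((ltDivTower hπ 1 : (maxNilIdealC F).toIdeal) : CBall F) : CompletedAlgClosure F) ^ residueFieldCard F = 0 := by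
    have h := ltPoly_ltDivTower_succ hπ 0
    rwa [zero_add, hπD, coe_ltDivTower_zero, Subring.coe_zero] at h
  have ht0 : (((ltDivTower hπ 1 : (maxNilIdealC F).toIdeal) : CBall F) : CompletedAlgClosure F) ≠ 0 :=
    fun h => ltDivTower_one_ne_zero hπ (ZeroMemClass.coe_eq_zero.1 h)
  -- KEY: `y₀ ≠ 0`, and the convergence regime `‖y₀‖^{q-1} < ‖ρ‖`
  have hy₀0 : ((AinfRamTop.thetaConj D hρ x₀ : CBall F) : CompletedAlgClosure F) ≠ 0 := by
    rw [hy₀₁]; exact ltMap_ne_zero_of_norm_sub_le hq3 hρϖ hne hϖ1 ht ht0 hy₁le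
  have hy₀reg : ‖((AinfRamTop.thetaConj D hρ x₀ : CBall F) : CompletedAlgClosure F)‖ ^ (residueFieldCard F - 1) <
      ‖((e D.root : NormedAlgClosure F) : CompletedAlgClosure F)‖ := by
    have h1 : ‖((AinfRamTop.thetaConj D hρ x₀ : CBall F) : CompletedAlgClosure F)‖ ≤
        ‖((e D.root : NormedAlgClosure F) : CompletedAlgClosure F)‖ := by
      refine hy₀le.trans ?_
      have h := IsUltrametricDist.norm_add_le_max ((e D.root : NormedAlgClosure F) : CompletedAlgClosure F)
        (-algebraMap F (CompletedAlgClosure F) D.root)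
      rwa [← sub_eq_add_neg, norm_neg, ← hρϖ, max_self] at h
    calc _ ≤ ‖((e D.root : NormedAlgClosure F) : CompletedAlgClosure F)‖ ^ (residueFieldCard F - 1) :=
          pow_le_pow_left₀ (norm_nonneg _) h1 _
      _ < _ := pow_lt_self_of_lt_one₀ (norm_pos_iff.2 hρ0) hρ1 (by omega)
  -- the eigenvector `u = λ_ρ(y₀)`
  refine ⟨LangLimit.langLog ((e D.root : NormedAlgClosure F) : CompletedAlgClosure F) (residueFieldCard F)
      ((AinfRamTop.thetaConj D hρ x₀ : CBall F) : CompletedAlgClosure F),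
    LangLimit.langLog_ne_zero hq2 hρ0 hρ1 hy₀reg hy₀0, fun σ hσM => ?_⟩
  -- `σ` fixes `ρ = e(π) ∈ M`
  have hσρ : σ • ((e D.root : NormedAlgClosure F) : CompletedAlgClosure F) =
      ((e D.root : NormedAlgClosure F) : CompletedAlgClosure F) := by
    rw [CompletedAlgClosure.smul_coe, hσM _ (hM e D.root)]
  -- `σ x_t = [a]_P x_t` with `a ↦ χ_π(σ)` under `𝒪_D → 𝒪_F`, and `θ_ρ(a) = e(χ_π σ)`
  obtain ⟨a, ha⟩ := EisensteinRoot.CoeffDisc.exists_toInt_eq_lubinTateChar D hπD hk hπ σ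
  have hX : AinfRamTop.gal D σ ((⟨x₀, hx₀mem⟩ : (AinfRamTop.nilTheta D hθ).toIdeal) : AinfRamTop D) =
      (ltSMul (AinfRamTop.nilTheta D hθ) hA hf a ⟨x₀, hx₀mem⟩ : AinfRamTop D) :=
    AinfRamTop.gal_ltTorsionLift_of_galSeq_eq (hθ := hθ) hA hf hpq AinfRamTop.algebraMap_varpiDisc_pow_mem_ideal σ a
      htp (EisensteinRoot.galSeq_ltDivTower D hπ hπD hA hf σ ha)
  have hκ : ((AinfRamTop.thetaConj D hρ (algebraMap (EisensteinRoot.CoeffDisc D) (AinfRamTop D) a) : CBall F) :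
        CompletedAlgClosure F) =
      ((e ((lubinTateChar hπ σ : 𝒪[F]) : F) : NormedAlgClosure F) : CompletedAlgClosure F) := by
    have ha' : a = EisensteinRoot.CoeffDisc.of D ((EisensteinRoot.CoeffDisc.of D).symm a) :=
      ((EisensteinRoot.CoeffDisc.of D).apply_symm_apply a).symm
    rw [← ha, ha', AinfRamTop.coe_thetaConj_algebraMap_coeffDisc, ← EisensteinRoot.CoeffDisc.coe_toInt]
  -- the quadratic bound along the orbit, linearised by Lang's limit
  have hbound := AinfRamTop.norm_ltMap_iterate_smul_sub_le D hA hf hρ σ hσρ a hX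
  simp only [hκc] at hbound
  rw [CompletedAlgClosure.smul_def, LangLimit.map_langLog hq2 hρ0 hρ1 hy₀reg (CompletedAlgClosure.galRingHom σ)
      (CompletedAlgClosure.continuous_galRingHom σ) (by rw [← CompletedAlgClosure.smul_def, hσρ])
      (by rw [← CompletedAlgClosure.smul_def, CompletedAlgClosure.norm_smul]),
    ← CompletedAlgClosure.smul_def, ← hκ]
  exact LangLimit.langLog_eq_mul hq2 hρ0 hρ1 hy₀reg (AinfRamTop.norm_thetaConj_le_one D hρ _) hbound

end Literature.NumberTheory.PAdicHodge

end
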